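import Literature.Analysis.FluidPDE.AxisymNoSwirlWeightedCoSignedFluxSlice
import HarnessLib

/-!
# Axisymmetric flows without swirl: the WEIGHTED co-signed flux — time balance of
# `∫ r²g β(η)(t) dx` for a bounded weight and a convex functional
# (weighted form of Gallay–Šverák 2015, Lemma 5.1 / Lemma 6.4)

Analysis/FluidPDE proof file (theorems only; no definitions, no named facts).  Second step of
the weighted co-signed flux (see `AxisymNoSwirlWeightedCoSignedFluxSlice` for the context:
Th. Gallay, V. Šverák, Confluentes Math. 7 (2015) 67–92 = arXiv:1510.01036, Lemma 5.1 tested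
against the impulse weight `r²` of Lemma 6.4).  Along a Tao-class solution `(v, q)` on `[0, T]`
from an axisymmetric swirl-free datum, `Ω(t) = angVortQuot (v t) = ω_θ/r`:

* `IsTaoSolutionOn.integral_weight_mul_comp_angVortQuot_eq_add` — **time balance** for a
  continuous BOUNDED weight `φ` and an admissible `β ∈ C²` (`β(0) = β'(0) = 0`, `|β''| ≤ K`):
  `∫ φ β(Ω(b)) = ∫ φ β(Ω(0)) + ∫_{t∈(0,b)} ∫ φ β'(Ω(t)) Ω'(t)`, `Ω'(t) = angVortQuot (∂ₜv t)`
  (the tree's balance lemma `integral_comp_eq_add_of_ae_hasDerivAt` applied to the family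
  `φ(x) β(Ω(t,x))`; time lines are smooth, `φβ'(Ω)Ω'` is jointly measurable with
  `∫|φβ'(Ω)Ω'| ≤ C_φ K (sup‖Ω‖₂² + sup‖Ω'‖₂²)`), with the time-integrability of the slice pairing
  (`…integrableOn_integral_weight_mul_deriv_comp_mul`);
* `IsTaoSolutionOn.integral_rsq_weight_mul_comp_angVortQuot_le` — **the weighted convex balance**
  for `φ = r²g`, `g ∈ C²`, `g ≥ 0` with `r²g, x₀g, x₁g, r²∂ᵢg, div(r²∇g)` bounded by `C_g`,
  convex admissible `β` (`0 ≤ β'' ≤ K`) and `0 < ν`: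
  `∫ r²g β(Ω(b)) ≤ ∫ r²g β(Ω(0)) + ∫_{t∈(0,b)} (∫ β(Ω(t)) D(r²g)[v(t)] + ν ∫ β(Ω(t)) div(r²∇g))`
  (the balance plus the slice inequality
  `IsTaoSolutionOn.integral_weight_mul_deriv_comp_mul_angVortQuot_deriv_le`; the right-hand
  slice functional is time-integrable because `|β(Ω) D(r²g)[v]| ≤ 7 B C_g K Ω²` with `B = sup|v|`).

With `g = g_ε = (1 + ε|x|²)⁻²` (`AxisymNoSwirlImpulseWeights`) and `β = β_δ ↑ (·)^±`
(`AxisymNoSwirlCoSignedFlux`) and the limits `δ → 0`, `ε → 0` this yields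
`∫ r²η^±(b) ≤ ∫ r²η^±(0) + ∫₀ᵇ∫ 2(x₀v₀ + x₁v₁) η^±` (sequel). WHAT THIS IS NOT: not a
statement about blow-up — an a-priori balance for smooth swirl-free axisymmetric flows.

## Mathlib / tree search

Tree (used): `integral_comp_eq_add_of_ae_hasDerivAt`, `aestronglyMeasurable_prod_of_continuousOn_off_axis`
(`AxisymNoSwirlCoSignedFlux`, `SqIntegralBalance`), `IsSmoothSpaceTimeOn.angVortQuot_family`,
`…timeDerivWithin_angVortQuot`, `IsTaoSolutionOn.exists_lintegral_sq_quot_le`,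
`…memLp_angVortQuot_data`, `…exists_bound_velocity`, the slice inequality of
`AxisymNoSwirlWeightedCoSignedFluxSlice`; pattern of proof: `AxisymNoSwirlImpulseBalance`
(`β = id`). `lean search 'weight_mul_comp_angVortQuot|WeightedCoSignedBalance'`: nothing before
this file. Private copies of small convex-function lemmas (private in their home files) included.

## References

* Th. Gallay, V. Šverák, Confluentes Math. 7 (2015) 67–92 = arXiv:1510.01036, §5 Lemma 5.1
  (time integration of (5.1), arXiv p. 16), §6 Lemma 6.4 (arXiv p. 19). [GallaySverak2016]
-/

noncomputable section

open MeasureTheory Set Function Filter InnerProductSpace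
open _root_.Topology
open scoped NNReal ENNReal RealInnerProductSpace ContDiff

namespace Literature.Analysis.FluidPDE

/-! ### Convex `C²` functions (private copies) -/

section Convex

variable {β : ℝ → ℝ} {K : ℝ}

/-- For `β ∈ C²`: `β` and `β'` are differentiable. [folklore] -/
private theorem differentiable_deriv_of_contDiff_two₂ (hβ : ContDiff ℝ 2 β) :
    Differentiable ℝ β ∧ Differentiable ℝ (deriv β) := by
  refine ⟨hβ.differentiable (by norm_num), ?_⟩
  have h1 : ContDiff ℝ 1 (deriv β) := ContDiff.deriv' (n := 1) (by exact_mod_cast hβ)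
  exact h1.differentiable one_ne_zero

/-- If `β'(0) = 0` and `|β''| ≤ K` then `|β'(v)| ≤ K |v|`. [folklore] -/
private theorem abs_deriv_le_mul_abs₂ (hβ : ContDiff ℝ 2 β) (h0 : deriv β 0 = 0)
    (hK : ∀ v, |deriv (deriv β) v| ≤ K) (v : ℝ) : |deriv β v| ≤ K * |v| := by
  obtain ⟨-, hd'⟩ := differentiable_deriv_of_contDiff_two₂ hβ
  have h := Convex.norm_image_sub_le_of_norm_deriv_le (f := deriv β) (s := univ) (x := 0) (y := v)
    (fun x _ => hd' x) (fun x _ => by rw [Real.norm_eq_abs]; exact hK x) convex_univ (mem_univ _)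
    (mem_univ _)
  rw [h0, sub_zero, sub_zero, Real.norm_eq_abs, Real.norm_eq_abs] at h
  exact h

/-- If `β(0) = β'(0) = 0` and `|β''| ≤ K` then `|β(v)| ≤ K v²`. [folklore] -/
private theorem abs_le_mul_sq₂ (hβ : ContDiff ℝ 2 β) (h00 : β 0 = 0) (h0 : deriv β 0 = 0)
    (hK : ∀ v, |deriv (deriv β) v| ≤ K) (v : ℝ) : |β v| ≤ K * v ^ 2 := by
  obtain ⟨hd, -⟩ := differentiable_deriv_of_contDiff_two₂ hβ
  have hK0 : 0 ≤ K := (abs_nonneg _).trans (hK 0)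
  have hseg : ∀ x ∈ uIcc 0 v, ‖deriv β x‖ ≤ K * |v| := by
    intro x hx
    rw [Real.norm_eq_abs]
    refine (abs_deriv_le_mul_abs₂ hβ h0 hK x).trans (mul_le_mul_of_nonneg_left ?_ hK0)
    rcases le_total 0 v with hv | hv
    · rw [uIcc_of_le hv] at hx
      rw [abs_of_nonneg hx.1, abs_of_nonneg hv]; exact hx.2
    · rw [uIcc_of_ge hv] at hx
      rw [abs_of_nonpos hx.2, abs_of_nonpos hv]; linarith [hx.1]
  have h := Convex.norm_image_sub_le_of_norm_deriv_le (f := β) (s := uIcc 0 v) (x := 0) (y := v)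
    (fun x _ => hd x) hseg (convex_uIcc 0 v) left_mem_uIcc right_mem_uIcc
  rw [h00, sub_zero, sub_zero, Real.norm_eq_abs, Real.norm_eq_abs] at h
  calc |β v| ≤ K * |v| * |v| := h
    _ = K * v ^ 2 := by rw [mul_assoc, abs_mul_abs_self, sq]

/-- `β(G) ∈ L¹` when `|β(v)| ≤ K v²` and `G ∈ L²` is continuous. [folklore] -/
private theorem integrable_comp₂ {G : EuclideanSpace ℝ (Fin 3) → ℝ} (hβ : ContDiff ℝ 2 β)
    (h00 : β 0 = 0) (h0 : deriv β 0 = 0) (hK : ∀ v, |deriv (deriv β) v| ≤ K) (hGc : Continuous G)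
    (hG : MemLp G 2 volume) : Integrable (fun x => β (G x)) := by
  obtain ⟨hd, -⟩ := differentiable_deriv_of_contDiff_two₂ hβ
  refine (hG.integrable_sq.const_mul K).mono' (hd.continuous.comp hGc).aestronglyMeasurable
    (Eventually.of_forall fun x => ?_)
  rw [Real.norm_eq_abs]
  exact abs_le_mul_sq₂ hβ h00 h0 hK (G x)

/-- `ab ≤ a² + b²` in `ℝ≥0∞`. [folklore] -/
private theorem ennreal_mul_le_sq_add_sq₃ (a b : ℝ≥0∞) : a * b ≤ a ^ 2 + b ^ 2 := by
  rcases le_total a b with hab | hab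
  · calc a * b ≤ b * b := by gcongr
      _ = b ^ 2 := (sq b).symm
      _ ≤ a ^ 2 + b ^ 2 := le_add_self
  · calc a * b ≤ a * a := by gcongr
      _ = a ^ 2 := (sq a).symm
      _ ≤ a ^ 2 + b ^ 2 := le_self_add

end Convex

/-! ### The derivative of the weight `r²g` along a bounded field is bounded -/

section Weight

variable {g : EuclideanSpace ℝ (Fin 3) → ℝ} {Cg : ℝ}

/-- A linear functional on `ℝ³` applied to a vector, in coordinates. [folklore] -/
private theorem clm_apply_eq_sum₃' (L : EuclideanSpace ℝ (Fin 3) →L[ℝ] ℝ) (w : EuclideanSpace ℝ (Fin 3)) :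
    L w = w 0 * L (EuclideanSpace.single 0 1) + w 1 * L (EuclideanSpace.single 1 1) +
      w 2 * L (EuclideanSpace.single 2 1) := by
  have hw : w = (w 0) • EuclideanSpace.single 0 (1 : ℝ) + (w 1) • EuclideanSpace.single 1 (1 : ℝ) +
      (w 2) • EuclideanSpace.single 2 (1 : ℝ) := by
    ext i
    fin_cases i <;> simp
  conv_lhs => rw [hw]
  rw [map_add, map_add, map_smul, map_smul, map_smul, smul_eq_mul, smul_eq_mul, smul_eq_mul]

/-- Product rule for the weight `φ = r² g`: `Dφ(x)[w] = 2(x₀w₀ + x₁w₁) g(x) + r² Dg(x)[w]`. [folklore] -/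
private theorem fderiv_cylRadius_sq_mul_apply₂ (hg : Differentiable ℝ g) (x w : EuclideanSpace ℝ (Fin 3)) :
    fderiv ℝ (fun y => cylRadius y ^ 2 * g y) x w =
      2 * (x 0 * w 0 + x 1 * w 1) * g x + cylRadius x ^ 2 * fderiv ℝ g x w := by
  have hθ : HasFDerivAt (fun y : EuclideanSpace ℝ (Fin 3) => cylRadius y ^ 2)
      ((2 * x 0) • (EuclideanSpace.proj (0 : Fin 3) : EuclideanSpace ℝ (Fin 3) →L[ℝ] ℝ) +
        (2 * x 1) • (EuclideanSpace.proj (1 : Fin 3) : EuclideanSpace ℝ (Fin 3) →L[ℝ] ℝ)) x :=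
    hasFDerivAt_cylRadius_sq x
  rw [fderiv_fun_mul hθ.differentiableAt (hg x), hθ.fderiv]
  simp only [_root_.add_apply, _root_.smul_apply, smul_eq_mul]
  have hp : ∀ i : Fin 3, (EuclideanSpace.proj i : EuclideanSpace ℝ (Fin 3) →L[ℝ] ℝ) w = w i :=
    fun i => rfl
  rw [hp 0, hp 1]
  ring

/-- **The drift of the weight is bounded**: if `|x₀g|, |x₁g|, |r²∂ᵢg| ≤ C_g` and `‖w‖ ≤ B` then
`|D(r²g)(x)[w]| ≤ 7 B C_g` (bound on the drift of the impulse weight `r²g` in the proof of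
Lemma 6.4). [cite: GallaySverak2016, §6 proof of Lemma 6.4 (arXiv p. 19); formalization step] -/
theorem abs_fderiv_rsq_mul_apply_le (hg : Differentiable ℝ g)
    (hgx0 : ∀ x, |x 0 * g x| ≤ Cg) (hgx1 : ∀ x, |x 1 * g x| ≤ Cg)
    (hgD : ∀ (i : Fin 3) x, |cylRadius x ^ 2 * fderiv ℝ g x (EuclideanSpace.single i 1)| ≤ Cg)
    {B : ℝ} {w : EuclideanSpace ℝ (Fin 3)} (hw : ‖w‖ ≤ B) (x : EuclideanSpace ℝ (Fin 3)) :
    |fderiv ℝ (fun y => cylRadius y ^ 2 * g y) x w| ≤ 7 * B * Cg := by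
  have hB0 : 0 ≤ B := (norm_nonneg _).trans hw
  have hCg : 0 ≤ Cg := (abs_nonneg _).trans (hgx0 0)
  have hbi : ∀ i : Fin 3, |w i| ≤ B := fun i => by
    have := PiLp.norm_apply_le w i
    rw [Real.norm_eq_abs] at this
    exact this.trans hw
  rw [fderiv_cylRadius_sq_mul_apply₂ hg, clm_apply_eq_sum₃' (fderiv ℝ g x) w]
  have e : 2 * (x 0 * w 0 + x 1 * w 1) * g x + cylRadius x ^ 2 *
      (w 0 * fderiv ℝ g x (EuclideanSpace.single 0 1) +
        w 1 * fderiv ℝ g x (EuclideanSpace.single 1 1) +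
        w 2 * fderiv ℝ g x (EuclideanSpace.single 2 1)) =
      2 * w 0 * (x 0 * g x) + 2 * w 1 * (x 1 * g x) +
      w 0 * (cylRadius x ^ 2 * fderiv ℝ g x (EuclideanSpace.single 0 1)) +
      w 1 * (cylRadius x ^ 2 * fderiv ℝ g x (EuclideanSpace.single 1 1)) +
      w 2 * (cylRadius x ^ 2 * fderiv ℝ g x (EuclideanSpace.single 2 1)) := by ring
  rw [e]
  have t1 : |2 * w 0 * (x 0 * g x)| ≤ 2 * B * Cg := by
    rw [abs_mul, abs_mul, abs_two]
    exact mul_le_mul (mul_le_mul_of_nonneg_left (hbi 0) zero_le_two) (hgx0 x) (abs_nonneg _)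
      (by positivity)
  have t2 : |2 * w 1 * (x 1 * g x)| ≤ 2 * B * Cg := by
    rw [abs_mul, abs_mul, abs_two]
    exact mul_le_mul (mul_le_mul_of_nonneg_left (hbi 1) zero_le_two) (hgx1 x) (abs_nonneg _)
      (by positivity)
  have t3 : ∀ i : Fin 3, |w i * (cylRadius x ^ 2 * fderiv ℝ g x (EuclideanSpace.single i 1))| ≤
      B * Cg := fun i => by
    rw [abs_mul]
    exact mul_le_mul (hbi i) (hgD i x) (abs_nonneg _) hB0
  have h30 := t3 0
  have h31 := t3 1
  have h32 := t3 2
  calc _ ≤ |2 * w 0 * (x 0 * g x)| + |2 * w 1 * (x 1 * g x)| +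
        |w 0 * (cylRadius x ^ 2 * fderiv ℝ g x (EuclideanSpace.single 0 1))| +
        |w 1 * (cylRadius x ^ 2 * fderiv ℝ g x (EuclideanSpace.single 1 1))| +
        |w 2 * (cylRadius x ^ 2 * fderiv ℝ g x (EuclideanSpace.single 2 1))| := by
          refine (abs_add_le _ _).trans ?_
          gcongr
          refine (abs_add_le _ _).trans ?_
          gcongr
          refine (abs_add_le _ _).trans ?_
          gcongr
          exact abs_add_le _ _
    _ ≤ 2 * B * Cg + 2 * B * Cg + B * Cg + B * Cg + B * Cg := by linarith
    _ = 7 * B * Cg := by ring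

end Weight

/-! ### The time balance of `∫ φ β(Ω(t))` for a bounded weight -/

section Balance

variable {T ν : ℝ} {u₀ : EuclideanSpace ℝ (Fin 3) → EuclideanSpace ℝ (Fin 3)}
  {v : ℝ → EuclideanSpace ℝ (Fin 3) → EuclideanSpace ℝ (Fin 3)}
  {q : ℝ → EuclideanSpace ℝ (Fin 3) → ℝ} {β : ℝ → ℝ} {K Cφ : ℝ}
  {φ : EuclideanSpace ℝ (Fin 3) → ℝ}

/-- **Joint measurability and the uniform `L¹` bound of `φ β'(Ω) Ω'`** along a Tao-class solution
with axisymmetric slices, for a continuous bounded weight `φ` (`|φ| ≤ C_φ`) and `β ∈ C²` with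
`β'(0) = 0`, `|β''| ≤ K`: the space-time integrand `(t, x) ↦ φ(x) β'(Ω(t,x)) Ω'(t,x)` is
a.e.-strongly measurable on `(0,T) × ℝ³` and `∫ |φ β'(Ω(t)) Ω'(t)| ≤ C_φ K (C + C)` with the
uniform `L²` bound `C` of `Ω`, `Ω'` (`IsTaoSolutionOn.exists_lintegral_sq_quot_le`).
[cite: GallaySverak2016, §5 Lemma 5.1 proof (arXiv p. 16)] -/
theorem IsTaoSolutionOn.weight_mul_deriv_comp_mul_data (h : IsTaoSolutionOn T ν u₀ v q)
    (hT : 0 < T) (hax : ∀ t ∈ Icc 0 T, IsAxisymmetric (v t))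
    (hβ : ContDiff ℝ 2 β) (hβ0 : deriv β 0 = 0) (hK : ∀ w, |deriv (deriv β) w| ≤ K)
    (hφc : Continuous φ) (hφb : ∀ x, |φ x| ≤ Cφ) :
    AEStronglyMeasurable (uncurry fun t x => φ x * (deriv β (angVortQuot (v t) x) *
        angVortQuot (timeDerivWithin (Icc 0 T) v t) x)) ((volume.restrict (Ioo 0 T)).prod volume) ∧
    ∃ M : ℝ≥0∞, M ≠ ⊤ ∧ ∀ t ∈ Ioo 0 T, ∫⁻ x, ‖φ x * (deriv β (angVortQuot (v t) x) *
        angVortQuot (timeDerivWithin (Icc 0 T) v t) x)‖ₑ ≤ M := by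
  have hU : UniqueDiffOn ℝ (Icc 0 T) := uniqueDiffOn_Icc hT
  have hcl := Icc_subset_closure_interior_Icc' hT
  have hsm : IsSmoothSpaceTimeOn (Icc 0 T) v := h.classical.smooth_velocity
  have hK0 : 0 ≤ K := (abs_nonneg _).trans (hK 0)
  have hCφ : 0 ≤ Cφ := (abs_nonneg _).trans (hφb 0)
  obtain ⟨-, hd'⟩ := differentiable_deriv_of_contDiff_two₂ hβ
  have hΩ : IsSmoothSpaceTimeOn (Icc 0 T) (fun t => angVortQuot (v t)) :=
    hsm.angVortQuot_family (convex_Icc 0 T) hU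
  have hΩ' : IsSmoothSpaceTimeOn (Icc 0 T) (timeDerivWithin (Icc 0 T) fun t => angVortQuot (v t)) :=
    hΩ.timeDerivWithin hU
  have hdt : ∀ t ∈ Icc 0 T, ∀ x, timeDerivWithin (Icc 0 T) (fun s => angVortQuot (v s)) t x =
      angVortQuot (timeDerivWithin (Icc 0 T) v t) x := fun t ht x =>
    hsm.timeDerivWithin_angVortQuot (convex_Icc 0 T) hU hcl hax ht x
  have hΩc : ∀ t ∈ Icc 0 T, Continuous (angVortQuot (v t)) := fun t ht =>
    (contDiff_angVortQuot (n := 0) (by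
      exact_mod_cast (h.classical.contDiff_velocity ht).of_le (by norm_cast))).continuous
  obtain ⟨C, hC⟩ := h.exists_lintegral_sq_quot_le hT hax
  refine ⟨?_, ENNReal.ofReal (Cφ * K) * ((C : ℝ≥0∞) + C),
    ENNReal.mul_ne_top ENNReal.ofReal_ne_top (by simp), fun t ht => ?_⟩
  · -- joint measurability from continuity off the axis
    refine aestronglyMeasurable_prod_of_continuousOn_off_axis ?_
    have hsub : Ioo 0 T ×ˢ {x : EuclideanSpace ℝ (Fin 3) | cylRadius x ≠ 0} ⊆ Icc 0 T ×ˢ univ :=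
      prod_mono Ioo_subset_Icc_self (subset_univ _)
    have c0 : ContinuousOn (fun p : ℝ × EuclideanSpace ℝ (Fin 3) => φ p.2) (Icc 0 T ×ˢ univ) :=
      (hφc.comp continuous_snd).continuousOn
    have c1 : ContinuousOn (fun p : ℝ × EuclideanSpace ℝ (Fin 3) => deriv β (uncurry (fun t x =>
        angVortQuot (v t) x) p)) (Icc 0 T ×ˢ univ) := hd'.continuous.comp_continuousOn hΩ.continuousOn
    have c2 : ContinuousOn (uncurry (timeDerivWithin (Icc 0 T) fun t => angVortQuot (v t)))
        (Icc 0 T ×ˢ univ) := hΩ'.continuousOn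
    refine ((c0.mul (c1.mul c2)).mono hsub).congr fun p hp => ?_
    obtain ⟨t, x⟩ := p
    have htI : t ∈ Icc 0 T := Ioo_subset_Icc_self hp.1
    simp only [Pi.mul_apply, uncurry_apply_pair]
    rw [hdt t htI x]
  · -- uniform `L¹` bound
    have htI : t ∈ Icc 0 T := Ioo_subset_Icc_self ht
    obtain ⟨hΩC, hΩ'C, -, -⟩ := hC t htI
    calc ∫⁻ x, ‖φ x * (deriv β (angVortQuot (v t) x) * angVortQuot (timeDerivWithin (Icc 0 T) v t) x)‖ₑ
        ≤ ∫⁻ x, ENNReal.ofReal (Cφ * K) * (‖angVortQuot (v t) x‖ₑ ^ 2 +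
            ‖angVortQuot (timeDerivWithin (Icc 0 T) v t) x‖ₑ ^ 2) := by
          refine lintegral_mono fun x => ?_
          rw [enorm_mul, enorm_mul]
          have hb := abs_deriv_le_mul_abs₂ hβ hβ0 hK (angVortQuot (v t) x)
          have h1 : ‖φ x‖ₑ * ‖deriv β (angVortQuot (v t) x)‖ₑ ≤
              ENNReal.ofReal (Cφ * K) * ‖angVortQuot (v t) x‖ₑ := by
            rw [Real.enorm_eq_ofReal_abs, Real.enorm_eq_ofReal_abs, Real.enorm_eq_ofReal_abs,
              ← ENNReal.ofReal_mul (abs_nonneg _), ← ENNReal.ofReal_mul (by positivity)]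
            refine ENNReal.ofReal_le_ofReal ?_
            calc |φ x| * |deriv β (angVortQuot (v t) x)| ≤ Cφ * (K * |angVortQuot (v t) x|) :=
                  mul_le_mul (hφb x) hb (abs_nonneg _) hCφ
              _ = Cφ * K * |angVortQuot (v t) x| := by ring
          calc ‖φ x‖ₑ * (‖deriv β (angVortQuot (v t) x)‖ₑ *
                ‖angVortQuot (timeDerivWithin (Icc 0 T) v t) x‖ₑ)
              = (‖φ x‖ₑ * ‖deriv β (angVortQuot (v t) x)‖ₑ) *
                  ‖angVortQuot (timeDerivWithin (Icc 0 T) v t) x‖ₑ := (mul_assoc _ _ _).symm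
            _ ≤ (ENNReal.ofReal (Cφ * K) * ‖angVortQuot (v t) x‖ₑ) *
                  ‖angVortQuot (timeDerivWithin (Icc 0 T) v t) x‖ₑ := by gcongr
            _ = ENNReal.ofReal (Cφ * K) * (‖angVortQuot (v t) x‖ₑ *
                  ‖angVortQuot (timeDerivWithin (Icc 0 T) v t) x‖ₑ) := mul_assoc _ _ _
            _ ≤ ENNReal.ofReal (Cφ * K) * (‖angVortQuot (v t) x‖ₑ ^ 2 +
                  ‖angVortQuot (timeDerivWithin (Icc 0 T) v t) x‖ₑ ^ 2) := by
                gcongr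
                exact ennreal_mul_le_sq_add_sq₃ _ _
      _ = ENNReal.ofReal (Cφ * K) * ((∫⁻ x, ‖angVortQuot (v t) x‖ₑ ^ 2) +
            ∫⁻ x, ‖angVortQuot (timeDerivWithin (Icc 0 T) v t) x‖ₑ ^ 2) := by
          have hmΩ : Measurable fun x => ‖angVortQuot (v t) x‖ₑ ^ 2 :=
            (hΩc t htI).measurable.enorm.pow_const 2
          rw [lintegral_const_mul' _ _ ENNReal.ofReal_ne_top, lintegral_add_left hmΩ]
      _ ≤ ENNReal.ofReal (Cφ * K) * ((C : ℝ≥0∞) + C) := by gcongr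

/-- **Time balance of a weighted convex functional of `ω_θ/r` in Tao's class** (time
integration of Gallay–Šverák's (5.1) against a bounded weight).  Let `(v, q)` be a Tao-class
solution on `[0, T]` (`0 < T`) with axisymmetric slices, `Ω(t) = angVortQuot (v t)`,
`Ω'(t) = angVortQuot (∂ₜv t)`; let `φ` be continuous with `|φ| ≤ C_φ` and `β ∈ C²` with
`β(0) = β'(0) = 0`, `|β''| ≤ K`.  Then for every `b ∈ (0, T]`:
`∫ φ β(Ω(b)) dx = ∫ φ β(Ω(0)) dx + ∫_{t∈(0,b)} ∫ φ β'(Ω(t)) Ω'(t) dx dt`.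
[cite: GallaySverak2016, §5 Lemma 5.1 proof (time integration of (5.1), arXiv p. 16)] -/
theorem IsTaoSolutionOn.integral_weight_mul_comp_angVortQuot_eq_add (h : IsTaoSolutionOn T ν u₀ v q)
    (hT : 0 < T) (hax : ∀ t ∈ Icc 0 T, IsAxisymmetric (v t))
    (hβ : ContDiff ℝ 2 β) (h00 : β 0 = 0) (hβ0 : deriv β 0 = 0) (hK : ∀ w, |deriv (deriv β) w| ≤ K)
    (hφc : Continuous φ) (hφb : ∀ x, |φ x| ≤ Cφ) {b : ℝ} (hb : b ∈ Ioc 0 T) :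
    ∫ x, φ x * β (angVortQuot (v b) x) = (∫ x, φ x * β (angVortQuot (v 0) x)) +
      ∫ t in Ioo 0 b, ∫ x, φ x * (deriv β (angVortQuot (v t) x) *
        angVortQuot (timeDerivWithin (Icc 0 T) v t) x) := by
  have hU : UniqueDiffOn ℝ (Icc 0 T) := uniqueDiffOn_Icc hT
  have hcl := Icc_subset_closure_interior_Icc' hT
  have hsm : IsSmoothSpaceTimeOn (Icc 0 T) v := h.classical.smooth_velocity
  obtain ⟨hd, hd'⟩ := differentiable_deriv_of_contDiff_two₂ hβ
  have hΩ : IsSmoothSpaceTimeOn (Icc 0 T) (fun t => angVortQuot (v t)) :=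
    hsm.angVortQuot_family (convex_Icc 0 T) hU
  have hΩ' : IsSmoothSpaceTimeOn (Icc 0 T) (timeDerivWithin (Icc 0 T) fun t => angVortQuot (v t)) :=
    hΩ.timeDerivWithin hU
  have hdt : ∀ t ∈ Icc 0 T, ∀ x, timeDerivWithin (Icc 0 T) (fun s => angVortQuot (v s)) t x =
      angVortQuot (timeDerivWithin (Icc 0 T) v t) x := fun t ht x =>
    hsm.timeDerivWithin_angVortQuot (convex_Icc 0 T) hU hcl hax ht x
  have hΩc : ∀ t ∈ Icc 0 T, Continuous (angVortQuot (v t)) := fun t ht =>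
    (contDiff_angVortQuot (n := 0) (by
      exact_mod_cast (h.classical.contDiff_velocity ht).of_le (by norm_cast))).continuous
  have tl : ∀ {w : ℝ → EuclideanSpace ℝ (Fin 3) → ℝ},
      ContinuousOn (uncurry w) (Icc 0 T ×ˢ univ) → ∀ x, ContinuousOn (fun s => w s x) (Icc 0 T) := by
    intro w hw x
    exact hw.comp (continuous_id.prodMk continuous_const).continuousOn
      fun s hs => mk_mem_prod hs (mem_univ x)
  -- (1) time lines
  have hline : ∀ᵐ x ∂(volume : Measure (EuclideanSpace ℝ (Fin 3))),
      ContinuousOn (fun t => φ x * β (angVortQuot (v t) x)) (Icc 0 T) ∧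
      ContinuousOn (fun t => φ x * (deriv β (angVortQuot (v t) x) *
        angVortQuot (timeDerivWithin (Icc 0 T) v t) x)) (Icc 0 T) ∧
      ∀ t ∈ Ioo 0 T, HasDerivAt (fun t => φ x * β (angVortQuot (v t) x))
        (φ x * (deriv β (angVortQuot (v t) x) * angVortQuot (timeDerivWithin (Icc 0 T) v t) x)) t := by
    refine ae_of_all _ fun x => ⟨continuousOn_const.mul (hd.continuous.comp_continuousOn
      (tl hΩ.continuousOn x)), continuousOn_const.mul
        ((hd'.continuous.comp_continuousOn (tl hΩ.continuousOn x)).mul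
          ((tl hΩ'.continuousOn x).congr fun s hs => (hdt s hs x).symm)), fun t ht => ?_⟩
    have htI : t ∈ Icc 0 T := Ioo_subset_Icc_self ht
    have h1 : HasDerivWithinAt (fun s => angVortQuot (v s) x)
        (timeDerivWithin (Icc 0 T) (fun s => angVortQuot (v s)) t x) (Icc 0 T) t := by
      rw [timeDerivWithin_apply]
      exact (hΩ.differentiableWithinAt_time htI x).hasDerivWithinAt
    rw [hdt t htI x] at h1
    have h2 : HasDerivAt (fun s => angVortQuot (v s) x)
        (angVortQuot (timeDerivWithin (Icc 0 T) v t) x) t := h1.hasDerivAt (Icc_mem_nhds ht.1 ht.2)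
    exact ((hd (angVortQuot (v t) x)).hasDerivAt.comp t h2).const_mul (φ x)
  -- (2)+(3) measurability and the uniform bound
  obtain ⟨hmeas, M, hM, hbound⟩ := h.weight_mul_deriv_comp_mul_data hT hax hβ hβ0 hK hφc hφb
  -- (4) the slices `φ β(Ω(t))` are integrable
  have hint : ∀ t ∈ Icc 0 T, Integrable (fun x => φ x * β (angVortQuot (v t) x)) := by
    intro t ht
    have hi := integrable_comp₂ hβ h00 hβ0 hK (hΩc t ht) (h.memLp_angVortQuot_data hax ht).1
    exact hi.bdd_mul hφc.aestronglyMeasurable (ae_of_all _ fun x => by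
      rw [Real.norm_eq_abs]; exact hφb x)
  have key := integral_comp_eq_add_of_ae_hasDerivAt (μ := (volume : Measure (EuclideanSpace ℝ (Fin 3))))
    (T := T) (Φ := fun y : ℝ => y) (g := fun t x => φ x * β (angVortQuot (v t) x))
    (g' := fun t x => φ x * (deriv β (angVortQuot (v t) x) *
      angVortQuot (timeDerivWithin (Icc 0 T) v t) x)) contDiff_id hline
    (by simpa only [deriv_id'', one_mul] using hmeas) hM
    (fun t ht => by simpa only [deriv_id'', one_mul] using hbound t ht) hint hb
  simpa only [deriv_id'', one_mul] using key

/-- The slice pairing `t ↦ ∫ φ β'(Ω(t)) Ω'(t) dx` is integrable on `(0, T)` (Fubini, from the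
joint measurability and the uniform `L¹` bound).
[cite: GallaySverak2016, §5 Lemma 5.1 proof (time integration of (5.1), arXiv p. 16); formalization step] -/
theorem IsTaoSolutionOn.integrableOn_integral_weight_mul_deriv_comp_mul (h : IsTaoSolutionOn T ν u₀ v q)
    (hT : 0 < T) (hax : ∀ t ∈ Icc 0 T, IsAxisymmetric (v t))
    (hβ : ContDiff ℝ 2 β) (hβ0 : deriv β 0 = 0) (hK : ∀ w, |deriv (deriv β) w| ≤ K)
    (hφc : Continuous φ) (hφb : ∀ x, |φ x| ≤ Cφ) :
    IntegrableOn (fun t => ∫ x, φ x * (deriv β (angVortQuot (v t) x) *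
      angVortQuot (timeDerivWithin (Icc 0 T) v t) x)) (Ioo 0 T) := by
  obtain ⟨hmeas, M, hM, hbound⟩ := h.weight_mul_deriv_comp_mul_data hT hax hβ hβ0 hK hφc hφb
  have hI : Integrable (uncurry fun t x => φ x * (deriv β (angVortQuot (v t) x) *
      angVortQuot (timeDerivWithin (Icc 0 T) v t) x)) ((volume.restrict (Ioo 0 T)).prod volume) := by
    refine ⟨hmeas, ?_⟩
    have hle := lintegral_prod_le (μ := volume.restrict (Ioo 0 T))
      (ν := (volume : Measure (EuclideanSpace ℝ (Fin 3))))
      (fun z : ℝ × EuclideanSpace ℝ (Fin 3) => ‖uncurry (fun t x => φ x *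
        (deriv β (angVortQuot (v t) x) * angVortQuot (timeDerivWithin (Icc 0 T) v t) x)) z‖ₑ)
    refine lt_of_le_of_lt hle ?_
    calc ∫⁻ t in Ioo 0 T, ∫⁻ x, ‖uncurry (fun t x => φ x * (deriv β (angVortQuot (v t) x) *
          angVortQuot (timeDerivWithin (Icc 0 T) v t) x)) (t, x)‖ₑ
        ≤ ∫⁻ _ in Ioo 0 T, M := setLIntegral_mono' measurableSet_Ioo fun t ht => hbound t ht
      _ < ⊤ := by
          rw [setLIntegral_const]
          exact ENNReal.mul_lt_top hM.lt_top (by simp)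
  exact hI.integral_prod_left

end Balance

/-! ### The weighted convex balance for `φ = r²g` -/

section Weighted

variable {T ν : ℝ} {u₀ : EuclideanSpace ℝ (Fin 3) → EuclideanSpace ℝ (Fin 3)}
  {v : ℝ → EuclideanSpace ℝ (Fin 3) → EuclideanSpace ℝ (Fin 3)}
  {q : ℝ → EuclideanSpace ℝ (Fin 3) → ℝ} {β : ℝ → ℝ} {K Cg : ℝ}
  {g : EuclideanSpace ℝ (Fin 3) → ℝ}

/-- **The right-hand slice functional is integrable in time.**  Along a Tao-class solution with
axisymmetric slices, for `β ∈ C²` with `β(0) = β'(0) = 0`, `|β''| ≤ K`, and a weight `g ∈ C²`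
with `x₀g, x₁g, r²∂ᵢg, div(r²∇g)` bounded by `C_g`, the space-time function
`(t, x) ↦ β(Ω(t,x)) · (D(r²g)(x)[v(t,x)] + ν div(r²∇g)(x))` is integrable on `(0,T) × ℝ³`
(`|·| ≤ (7B + |ν|) C_g K Ω²`, `sup_t ‖Ω(t)‖₂² ≤ C`); hence its slice integrals are integrable in
`t`. [cite: GallaySverak2016, §6 proof of Lemma 6.4 (arXiv p. 19); formalization step] -/
theorem IsTaoSolutionOn.integrable_comp_angVortQuot_mul_drift (h : IsTaoSolutionOn T ν u₀ v q)
    (hT : 0 < T) (hax : ∀ t ∈ Icc 0 T, IsAxisymmetric (v t))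
    (hβ : ContDiff ℝ 2 β) (h00 : β 0 = 0) (hβ0 : deriv β 0 = 0) (hK : ∀ w, |deriv (deriv β) w| ≤ K)
    (hg : ContDiff ℝ 2 g) (hgx0 : ∀ x, |x 0 * g x| ≤ Cg) (hgx1 : ∀ x, |x 1 * g x| ≤ Cg)
    (hgD : ∀ (i : Fin 3) x, |cylRadius x ^ 2 * fderiv ℝ g x (EuclideanSpace.single i 1)| ≤ Cg)
    (hgdiv : ∀ x, |VectorCalculus.divergence (fun y => (cylRadius y ^ 2) • gradient g y) x| ≤ Cg) :
    Integrable (uncurry fun t x => β (angVortQuot (v t) x) *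
        (fderiv ℝ (fun y => cylRadius y ^ 2 * g y) x (v t x) +
          ν * VectorCalculus.divergence (fun y => (cylRadius y ^ 2) • gradient g y) x))
      ((volume.restrict (Ioo 0 T)).prod volume) := by
  have hU : UniqueDiffOn ℝ (Icc 0 T) := uniqueDiffOn_Icc hT
  have hsm : IsSmoothSpaceTimeOn (Icc 0 T) v := h.classical.smooth_velocity
  obtain ⟨hd, -⟩ := differentiable_deriv_of_contDiff_two₂ hβ
  have hK0 : 0 ≤ K := (abs_nonneg _).trans (hK 0)
  have hCg : 0 ≤ Cg := (abs_nonneg _).trans (hgx0 0)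
  have hg1 : ContDiff ℝ 1 g := hg.of_le (by norm_num)
  have hgd : Differentiable ℝ g := hg1.differentiable one_ne_zero
  have hΩ : IsSmoothSpaceTimeOn (Icc 0 T) (fun t => angVortQuot (v t)) :=
    hsm.angVortQuot_family (convex_Icc 0 T) hU
  have hΩc : ∀ t ∈ Icc 0 T, Continuous (angVortQuot (v t)) := fun t ht =>
    (contDiff_angVortQuot (n := 0) (by
      exact_mod_cast (h.classical.contDiff_velocity ht).of_le (by norm_cast))).continuous
  obtain ⟨B, hB0, hB⟩ := h.exists_bound_velocity
  obtain ⟨C, hC⟩ := h.exists_lintegral_sq_quot_le hT hax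
  -- regularity of the weight terms
  have hr2 : ContDiff ℝ 1 fun y : EuclideanSpace ℝ (Fin 3) => cylRadius y ^ 2 := by
    have : (fun y : EuclideanSpace ℝ (Fin 3) => cylRadius y ^ 2) = fun y => y 0 ^ 2 + y 1 ^ 2 :=
      funext cylRadius_sq
    rw [this]; fun_prop
  have hφ1 : ContDiff ℝ 1 fun y => cylRadius y ^ 2 * g y := hr2.mul hg1
  have hgradg : ContDiff ℝ 1 (gradient g) :=
    (InnerProductSpace.toDual ℝ (EuclideanSpace ℝ (Fin 3))).symm.contDiff.comp
      (hg.fderiv_right (m := 1) le_rfl)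
  have hV : ContDiff ℝ 1 fun y => (cylRadius y ^ 2) • gradient g y := hr2.smul hgradg
  have hdivc : Continuous fun x =>
      VectorCalculus.divergence (fun y => (cylRadius y ^ 2) • gradient g y) x :=
    continuous_divergence (hV.continuous_fderiv one_ne_zero)
  set L : ℝ := (7 * B + |ν|) * Cg with hLdef
  have hL0 : 0 ≤ L := by positivity
  -- pointwise bound of the multiplier
  have hmult : ∀ t ∈ Icc 0 T, ∀ x, |fderiv ℝ (fun y => cylRadius y ^ 2 * g y) x (v t x) +
      ν * VectorCalculus.divergence (fun y => (cylRadius y ^ 2) • gradient g y) x| ≤ L := by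
    intro t ht x
    have h1 := abs_fderiv_rsq_mul_apply_le hgd hgx0 hgx1 hgD (hB t ht x) x
    have h2 : |ν * VectorCalculus.divergence (fun y => (cylRadius y ^ 2) • gradient g y) x| ≤
        |ν| * Cg := by
      rw [abs_mul]; exact mul_le_mul_of_nonneg_left (hgdiv x) (abs_nonneg _)
    calc _ ≤ |fderiv ℝ (fun y => cylRadius y ^ 2 * g y) x (v t x)| +
          |ν * VectorCalculus.divergence (fun y => (cylRadius y ^ 2) • gradient g y) x| :=
          abs_add_le _ _
      _ ≤ 7 * B * Cg + |ν| * Cg := add_le_add h1 h2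
      _ = L := by rw [hLdef]; ring
  refine ⟨?_, ?_⟩
  · -- joint measurability: everything is continuous on `[0,T] × ℝ³`
    have hsub : Ioo 0 T ×ˢ (univ : Set (EuclideanSpace ℝ (Fin 3))) ⊆ Icc 0 T ×ˢ univ :=
      prod_mono Ioo_subset_Icc_self Subset.rfl
    have c1 : ContinuousOn (fun p : ℝ × EuclideanSpace ℝ (Fin 3) =>
        β (uncurry (fun t x => angVortQuot (v t) x) p)) (Icc 0 T ×ˢ univ) :=
      hd.continuous.comp_continuousOn hΩ.continuousOn
    have c2 : ContinuousOn (fun p : ℝ × EuclideanSpace ℝ (Fin 3) =>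
        fderiv ℝ (fun y => cylRadius y ^ 2 * g y) p.2 (v p.1 p.2)) (Icc 0 T ×ˢ univ) :=
      ((hφ1.continuous_fderiv one_ne_zero).comp_continuousOn continuous_snd.continuousOn).clm_apply
        hsm.continuousOn
    have c3 : ContinuousOn (fun p : ℝ × EuclideanSpace ℝ (Fin 3) =>
        ν * VectorCalculus.divergence (fun y => (cylRadius y ^ 2) • gradient g y) p.2)
        (Icc 0 T ×ˢ univ) := (continuous_const.mul (hdivc.comp continuous_snd)).continuousOn
    have c : ContinuousOn (uncurry fun t x => β (angVortQuot (v t) x) *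
        (fderiv ℝ (fun y => cylRadius y ^ 2 * g y) x (v t x) +
          ν * VectorCalculus.divergence (fun y => (cylRadius y ^ 2) • gradient g y) x))
        (Ioo 0 T ×ˢ univ) := (c1.mul (c2.add c3)).mono hsub
    exact aestronglyMeasurable_prod_of_continuousOn_off_axis
      (c.mono (prod_mono Subset.rfl (subset_univ _)))
  · -- finite integral: slices bounded by `L K C`
    have hle := lintegral_prod_le (μ := volume.restrict (Ioo 0 T))
      (ν := (volume : Measure (EuclideanSpace ℝ (Fin 3))))
      (fun z : ℝ × EuclideanSpace ℝ (Fin 3) => ‖uncurry (fun t x => β (angVortQuot (v t) x) *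
        (fderiv ℝ (fun y => cylRadius y ^ 2 * g y) x (v t x) +
          ν * VectorCalculus.divergence (fun y => (cylRadius y ^ 2) • gradient g y) x)) z‖ₑ)
    refine lt_of_le_of_lt hle ?_
    have hslice : ∀ t ∈ Ioo 0 T, ∫⁻ x, ‖uncurry (fun t x => β (angVortQuot (v t) x) *
        (fderiv ℝ (fun y => cylRadius y ^ 2 * g y) x (v t x) +
          ν * VectorCalculus.divergence (fun y => (cylRadius y ^ 2) • gradient g y) x)) (t, x)‖ₑ ≤
        ENNReal.ofReal (L * K) * C := by
      intro t ht
      have htI : t ∈ Icc 0 T := Ioo_subset_Icc_self ht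
      obtain ⟨hΩC, -, -, -⟩ := hC t htI
      calc _ ≤ ∫⁻ x, ENNReal.ofReal (L * K) * ‖angVortQuot (v t) x‖ₑ ^ 2 := by
            refine lintegral_mono fun x => ?_
            simp only [uncurry_apply_pair]
            rw [enorm_mul, Real.enorm_eq_ofReal_abs, Real.enorm_eq_ofReal_abs,
              Real.enorm_eq_ofReal_abs, ← ENNReal.ofReal_pow (abs_nonneg _), sq_abs,
              ← ENNReal.ofReal_mul (abs_nonneg _), ← ENNReal.ofReal_mul (by positivity)]
            refine ENNReal.ofReal_le_ofReal ?_
            have h1 := abs_le_mul_sq₂ hβ h00 hβ0 hK (angVortQuot (v t) x)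
            have h2 := hmult t htI x
            calc |β (angVortQuot (v t) x)| * _ ≤ (K * angVortQuot (v t) x ^ 2) * L :=
                  mul_le_mul h1 h2 (abs_nonneg _) (by positivity)
              _ = L * K * angVortQuot (v t) x ^ 2 := by ring
        _ = ENNReal.ofReal (L * K) * ∫⁻ x, ‖angVortQuot (v t) x‖ₑ ^ 2 := by
            rw [lintegral_const_mul' _ _ ENNReal.ofReal_ne_top]
        _ ≤ ENNReal.ofReal (L * K) * C := by gcongr
    calc _ ≤ ∫⁻ _ in Ioo 0 T, ENNReal.ofReal (L * K) * C :=
          setLIntegral_mono' measurableSet_Ioo fun t ht => hslice t ht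
      _ < ⊤ := by
          rw [setLIntegral_const]
          exact ENNReal.mul_lt_top (ENNReal.mul_lt_top ENNReal.ofReal_lt_top ENNReal.coe_lt_top) (by simp)

/-- **The weighted convex balance** (Gallay–Šverák 2015, Lemma 5.1 × Lemma 6.4, smooth class).
Let `(v, q)` be a Tao-class solution on `[0, T]` (`0 < ν`, `0 < T`) from an axisymmetric
swirl-free datum, `Ω(t) = angVortQuot (v t) = ω_θ/r`; let `β ∈ C²` with `β(0) = β'(0) = 0`,
`0 ≤ β'' ≤ K`, and let `g ∈ C²`, `g ≥ 0`, with `|r²g|, |x₀g|, |x₁g|, |r²∂ᵢg|, |div(r²∇g)| ≤ C_g`.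
Then for every `b ∈ (0, T]`:
`∫ r²g β(Ω(b)) ≤ ∫ r²g β(Ω(0)) + ∫_{t∈(0,b)} (∫ β(Ω(t)) D(r²g)[v(t)] + ν ∫ β(Ω(t)) div(r²∇g)) dt`.
[cite: GallaySverak2016, §5 Lemma 5.1 and §6 Lemma 6.4 (arXiv pp. 16, 19)] -/
theorem IsTaoSolutionOn.integral_rsq_weight_mul_comp_angVortQuot_le (h : IsTaoSolutionOn T ν u₀ v q)
    (hT : 0 < T) (hν : 0 < ν) (h0 : IsAxisymmetric u₀) (h0' : HasNoSwirl u₀)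
    (hβ : ContDiff ℝ 2 β) (h00 : β 0 = 0) (hβ0 : deriv β 0 = 0)
    (hnn : ∀ w, 0 ≤ deriv (deriv β) w) (hK : ∀ w, |deriv (deriv β) w| ≤ K)
    (hg : ContDiff ℝ 2 g) (hg0 : ∀ x, 0 ≤ g x)
    (hgr : ∀ x, |cylRadius x ^ 2 * g x| ≤ Cg)
    (hgx0 : ∀ x, |x 0 * g x| ≤ Cg) (hgx1 : ∀ x, |x 1 * g x| ≤ Cg)
    (hgD : ∀ (i : Fin 3) x, |cylRadius x ^ 2 * fderiv ℝ g x (EuclideanSpace.single i 1)| ≤ Cg)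
    (hgdiv : ∀ x, |VectorCalculus.divergence (fun y => (cylRadius y ^ 2) • gradient g y) x| ≤ Cg)
    {b : ℝ} (hb : b ∈ Ioc 0 T) :
    ∫ x, cylRadius x ^ 2 * g x * β (angVortQuot (v b) x) ≤
      (∫ x, cylRadius x ^ 2 * g x * β (angVortQuot (v 0) x)) +
      ∫ t in Ioo 0 b, ∫ x, β (angVortQuot (v t) x) *
        (fderiv ℝ (fun y => cylRadius y ^ 2 * g y) x (v t x) +
          ν * VectorCalculus.divergence (fun y => (cylRadius y ^ 2) • gradient g y) x) := by
  have hax : ∀ s ∈ Icc 0 T, IsAxisymmetric (v s) := h.isAxisymmetric hν hT h0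
  have hg1 : ContDiff ℝ 1 g := hg.of_le (by norm_num)
  have hφc : Continuous fun y => cylRadius y ^ 2 * g y := (continuous_cylRadius.pow 2).mul hg1.continuous
  obtain ⟨hd, -⟩ := differentiable_deriv_of_contDiff_two₂ hβ
  have hΩc : ∀ t ∈ Icc 0 T, Continuous (angVortQuot (v t)) := fun t ht =>
    (contDiff_angVortQuot (n := 0) (by
      exact_mod_cast (h.classical.contDiff_velocity ht).of_le (by norm_cast))).continuous
  -- the balance
  have hbal := h.integral_weight_mul_comp_angVortQuot_eq_add hT hax hβ h00 hβ0 hK hφc hgr hb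
  -- the slice inequality on `(0, b)`
  have hslice : ∀ t ∈ Ioo 0 b, ∫ x, (cylRadius x ^ 2 * g x) * (deriv β (angVortQuot (v t) x) *
      angVortQuot (timeDerivWithin (Icc 0 T) v t) x) ≤
      ∫ x, β (angVortQuot (v t) x) * (fderiv ℝ (fun y => cylRadius y ^ 2 * g y) x (v t x) +
        ν * VectorCalculus.divergence (fun y => (cylRadius y ^ 2) • gradient g y) x) := by
    intro t ht
    have htI : t ∈ Icc 0 T := ⟨ht.1.le, ht.2.le.trans hb.2⟩
    have hs := h.integral_weight_mul_deriv_comp_mul_angVortQuot_deriv_le hT hν h0 h0' hβ h00 hβ0 hnn hK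
      hg hg0 hgr hgx0 hgx1 hgD hgdiv htI
    have e1 : ∫ x, (cylRadius x ^ 2 * g x) * (deriv β (angVortQuot (v t) x) *
        angVortQuot (timeDerivWithin (Icc 0 T) v t) x) =
        ∫ x, cylRadius x ^ 2 * g x * deriv β (angVortQuot (v t) x) *
          angVortQuot (timeDerivWithin (Icc 0 T) v t) x :=
      integral_congr_ae (Eventually.of_forall fun x => by ring)
    -- the right-hand side: split the sum (both pieces integrable)
    obtain ⟨m0, -, -, -⟩ := h.memLp_angVortQuot_data hax htI
    have hβL1 : Integrable fun x => β (angVortQuot (v t) x) := integrable_comp₂ hβ h00 hβ0 hK (hΩc t htI) m0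
    obtain ⟨B, -, hB⟩ := h.exists_bound_velocity
    have hgd : Differentiable ℝ g := hg1.differentiable one_ne_zero
    have hφ1 : ContDiff ℝ 1 fun y => cylRadius y ^ 2 * g y := by
      have hr2 : ContDiff ℝ 1 fun y : EuclideanSpace ℝ (Fin 3) => cylRadius y ^ 2 := by
        have : (fun y : EuclideanSpace ℝ (Fin 3) => cylRadius y ^ 2) = fun y => y 0 ^ 2 + y 1 ^ 2 :=
          funext cylRadius_sq
        rw [this]; fun_prop
      exact hr2.mul hg1
    have iA : Integrable fun x => β (angVortQuot (v t) x) *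
        fderiv ℝ (fun y => cylRadius y ^ 2 * g y) x (v t x) := by
      have hm : AEStronglyMeasurable (fun x => fderiv ℝ (fun y => cylRadius y ^ 2 * g y) x (v t x))
          volume :=
        ((hφ1.continuous_fderiv one_ne_zero).clm_apply
          (h.classical.contDiff_velocity htI).continuous).aestronglyMeasurable
      have := hβL1.bdd_mul (c := 7 * B * Cg) hm (ae_of_all _ fun x => by
        rw [Real.norm_eq_abs]
        exact abs_fderiv_rsq_mul_apply_le hgd hgx0 hgx1 hgD (hB t htI x) x)
      exact this.congr (Eventually.of_forall fun x => mul_comm _ _)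
    have hgradg : ContDiff ℝ 1 (gradient g) :=
      (InnerProductSpace.toDual ℝ (EuclideanSpace ℝ (Fin 3))).symm.contDiff.comp
        (hg.fderiv_right (m := 1) le_rfl)
    have hr2' : ContDiff ℝ 1 fun y : EuclideanSpace ℝ (Fin 3) => cylRadius y ^ 2 := by
      have : (fun y : EuclideanSpace ℝ (Fin 3) => cylRadius y ^ 2) = fun y => y 0 ^ 2 + y 1 ^ 2 :=
        funext cylRadius_sq
      rw [this]; fun_prop
    have hV : ContDiff ℝ 1 fun y => (cylRadius y ^ 2) • gradient g y := hr2'.smul hgradg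
    have hdivc : Continuous fun x =>
        VectorCalculus.divergence (fun y => (cylRadius y ^ 2) • gradient g y) x :=
      continuous_divergence (hV.continuous_fderiv one_ne_zero)
    have iB : Integrable fun x => β (angVortQuot (v t) x) *
        (ν * VectorCalculus.divergence (fun y => (cylRadius y ^ 2) • gradient g y) x) := by
      have hm2 : AEStronglyMeasurable (fun x => ν *
          VectorCalculus.divergence (fun y => (cylRadius y ^ 2) • gradient g y) x) volume :=
        (continuous_const.mul hdivc).aestronglyMeasurable
      have := hβL1.bdd_mul (c := |ν| * Cg) hm2
        (ae_of_all _ fun x => by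
          rw [Real.norm_eq_abs, abs_mul]
          exact mul_le_mul_of_nonneg_left (hgdiv x) (abs_nonneg _))
      exact this.congr (Eventually.of_forall fun x => mul_comm _ _)
    have e2 : ∫ x, β (angVortQuot (v t) x) * (fderiv ℝ (fun y => cylRadius y ^ 2 * g y) x (v t x) +
        ν * VectorCalculus.divergence (fun y => (cylRadius y ^ 2) • gradient g y) x) =
        (∫ x, β (angVortQuot (v t) x) * fderiv ℝ (fun y => cylRadius y ^ 2 * g y) x (v t x)) +
        ν * ∫ x, β (angVortQuot (v t) x) *
          VectorCalculus.divergence (fun y => (cylRadius y ^ 2) • gradient g y) x := by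
      rw [← integral_const_mul, ← integral_add iA (iB.congr (Eventually.of_forall fun x => by ring))]
      exact integral_congr_ae (Eventually.of_forall fun x => by ring)
    rw [e1, e2]
    exact hs
  -- integrate the slice inequality over `(0, b)`
  have hIl : IntegrableOn (fun t => ∫ x, (cylRadius x ^ 2 * g x) * (deriv β (angVortQuot (v t) x) *
      angVortQuot (timeDerivWithin (Icc 0 T) v t) x)) (Ioo 0 b) :=
    (h.integrableOn_integral_weight_mul_deriv_comp_mul hT hax hβ hβ0 hK hφc hgr).mono_set
      (Ioo_subset_Ioo le_rfl hb.2)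
  have hIr : IntegrableOn (fun t => ∫ x, β (angVortQuot (v t) x) *
      (fderiv ℝ (fun y => cylRadius y ^ 2 * g y) x (v t x) +
        ν * VectorCalculus.divergence (fun y => (cylRadius y ^ 2) • gradient g y) x)) (Ioo 0 b) := by
    have hI := h.integrable_comp_angVortQuot_mul_drift hT hax hβ h00 hβ0 hK hg hgx0 hgx1 hgD hgdiv
    have hI' : IntegrableOn (fun t => ∫ x, β (angVortQuot (v t) x) *
        (fderiv ℝ (fun y => cylRadius y ^ 2 * g y) x (v t x) +
          ν * VectorCalculus.divergence (fun y => (cylRadius y ^ 2) • gradient g y) x)) (Ioo 0 T) :=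
      hI.integral_prod_left
    exact hI'.mono_set (Ioo_subset_Ioo le_rfl hb.2)
  have hmono := setIntegral_mono_on hIl hIr measurableSet_Ioo hslice
  rw [hbal]
  gcongr

end Weighted

end Literature.Analysis.FluidPDE

end
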